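import Mathlib
import HarnessLib
import Summits.NavierStokesRegularity.NavierStokesRegularity.Theorems.PoloidalWindowDoorLrcModEntireTwistingTHHyperbolicLayer
import Summits.NavierStokesRegularity.NavierStokesRegularity.Theorems.PoloidalWindowDoorLrcModEntireTwistingTHFlatSlab

/-!
# Item `LrcModEntire` (stmt-NavierStokesRegularity-20428), registry twist_split v7 — THE STRICT HYPERBOLIC LAYER (memo `Cruxes/LrcModEntire/T2B-g14.md` §14d):
# with the window pin, the slope of a surviving (TH) ridge is NEGATIVE on a punctured neighbourhood of the thread plane

LEAD of item 20428 ns-poloidal-K2-p3 g14 (`--supports stmt-NavierStokesRegularity-20428 --as helper`).  Composition of `…TwistingTHHyperbolicLayer.slope_dichotomy_of_hotPoint` (flat slab ∨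
`μ < 0` punctured) with `…TwistingTHFlatSlab.false_of_flatSlab` (a flat slab contradicts the window pin `(∂₂v)ₕ ≠ 0` at one point of `W`):

* `slope_neg_punctured_of_hotPoint` — class clauses + global bilinear (TH) + hot-spot normalisation + a transversally non-degenerate hot point + a non-flatness witness + ONE point
  `(t₀, x₀)` with `(∂₂v(t₀))₀(x₀) ≠ 0 ∨ (∂₂v(t₀))₁(x₀) ≠ 0` ⇒ **`μ(z) = ∂₂v_{c₁}(−1,y₁+z e₂)/∂_{c₁}v₂(−1,y₁+z e₂) < 0` for all small `z ≠ 0`**.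
With `…TwistingTHSlopeSign.slopeFunction_nonpos` (`μ(0) ≤ 0`): the thread plane of every surviving `stub_T2b` ridge lies in a layer `μ ≤ 0`, `μ < 0` off the plane — the slice
operator `μ(z)Δₕ + ∂_z²` is a WAVE operator in `z` on both sides (research cell (Q4), memo §13–§14).

WHAT THIS IS NOT: not a claim about Navier–Stokes regularity and not a proof of `stub_T2b` (bears_on LADDER-NS N0, item 20428 / crux 19708; both OPEN, ⟨27893⟩ OPEN).
-/

set_option linter.style.longLine false
set_option linter.dupNamespace false

namespace Summit.NavierStokesRegularity.NavierStokesRegularity.Theorems.PoloidalWindowDoorLrcModEntireTwistingTHHyperbolicLayerStrict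

open Set Function Filter Topology Metric
open scoped RealInnerProductSpace InnerProductSpace ContDiff
open Literature.Analysis Literature.Analysis.FluidPDE Literature.Analysis.UnboundedOperators
open Summit.NavierStokesRegularity.NavierStokesRegularity.Theorems
open Summit.NavierStokesRegularity.NavierStokesRegularity.Theorems.PoloidalWindowDoorLrcModEntireTwistingTHHyperbolicLayer
open Summit.NavierStokesRegularity.NavierStokesRegularity.Theorems.PoloidalWindowDoorLrcModEntireTwistingTHFlatSlab

variable {C : ℝ} {v : ℝ → EuclideanSpace ℝ (Fin 3) → EuclideanSpace ℝ (Fin 3)}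

/-- **THE STRICT HYPERBOLIC LAYER.**  See the module docstring. -/
theorem slope_neg_punctured_of_hotPoint (hdec : HasTypeITimeDecay C v) (hcont : ContinuousOn (uncurry v) (Iio (0 : ℝ) ×ˢ univ))
    (hmild : ∀ s t : ℝ, s < t → t < 0 → ∀ x, v t x = heatExtension (v s) (t - s) x - oseenDuhamel 1 s v v t x)
    (hdiv : ∀ t < 0, VectorCalculus.IsDivFree (v t))
    (hTH : ∀ t < 0, ∀ x x' : EuclideanSpace ℝ (Fin 3), x 2 = x' 2 → ∀ b c : Fin 3, b ≠ 2 → c ≠ 2 →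
      fderiv ℝ (v t) x (EuclideanSpace.single 2 1) b * fderiv ℝ (v t) x' (EuclideanSpace.single c 1) 2 =
        fderiv ℝ (v t) x' (EuclideanSpace.single 2 1) c * fderiv ℝ (v t) x (EuclideanSpace.single b 1) 2)
    (hhot : ∀ t < 0, ∀ x, Real.sqrt (-t) * |v t x 2| ≤ |v (-1) 0 2|)
    {σ : ℝ} (hσ : σ = 1 ∨ σ = -1) (hσN : 0 < σ * v (-1) 0 2)
    {y : EuclideanSpace ℝ (Fin 3)} (hy2 : y 2 = 0) (hyhot : v (-1) y 2 = v (-1) 0 2)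
    (hycrit : fderiv ℝ (fun x => v (-1) x 2) y (EuclideanSpace.single 2 1) = 0)
    (hΔ : σ * (fderiv ℝ (fun x => fderiv ℝ (fun x' => v (-1) x' 2) x (EuclideanSpace.single 0 (1 : ℝ))) y (EuclideanSpace.single 0 (1 : ℝ)) +
        fderiv ℝ (fun x => fderiv ℝ (fun x' => v (-1) x' 2) x (EuclideanSpace.single 1 (1 : ℝ))) y (EuclideanSpace.single 1 (1 : ℝ))) < 0)
    {y₁ : EuclideanSpace ℝ (Fin 3)} (hy₁ : y₁ 2 = 0) {c₁ : Fin 3} (hc₁ : c₁ ≠ 2)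
    (hne₁ : fderiv ℝ (v (-1)) y₁ (EuclideanSpace.single c₁ 1) 2 ≠ 0)
    (hpin : ∃ t₀ : ℝ, t₀ < 0 ∧ ∃ x₀ : EuclideanSpace ℝ (Fin 3),
      fderiv ℝ (v t₀) x₀ (EuclideanSpace.single 2 1) 0 ≠ 0 ∨ fderiv ℝ (v t₀) x₀ (EuclideanSpace.single 2 1) 1 ≠ 0) :
    ∀ᶠ z in 𝓝[≠] (0 : ℝ),
      fderiv ℝ (v (-1)) (y₁ + z • EuclideanSpace.single 2 (1 : ℝ)) (EuclideanSpace.single 2 1) c₁ /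
        fderiv ℝ (v (-1)) (y₁ + z • EuclideanSpace.single 2 (1 : ℝ)) (EuclideanSpace.single c₁ 1) 2 < 0 :=
  (slope_dichotomy_of_hotPoint hdec hcont hmild hdiv hTH hhot hσ hσN hy2 hyhot hycrit hΔ hy₁ hc₁ hne₁).resolve_left
    fun hflat => false_of_flatSlab hdec hcont hmild hdiv hpin hflat

end Summit.NavierStokesRegularity.NavierStokesRegularity.Theorems.PoloidalWindowDoorLrcModEntireTwistingTHHyperbolicLayerStrict
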